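/-
Origin: expansion seat `planner-pub-hodgecm-pv14-g6-0`, handover import Pv14g6.SchwartzWeilProjective -> import HodgeCM.Automorphic.SchwartzWeilProjective (Mathlib.Analysis.InnerProductSpace.Adjoint unchanged) ; after SchwartzStoneVonNeumann -> SchwartzWeilProjective (this seat, handed to RUN 29) (`HOME/pub-hodgecm-pv14-g6/lean/Pv14g6/SchwartzWeilLevi.lean`, md5 ef6322e5, 208 lines);
landed by the gen-8 packager in gate run 30 as `HodgeCM/Automorphic/SchwartzWeilLevi.lean` (import ^import Pv14g6\.SchwartzWeilProjective[ \t]*$→import HodgeCM.Automorphic.SchwartzWeilProjective ×1).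
-/
/-
Origin: `pub-hodgecm-pv14-g6/lean/Pv14g6/SchwartzWeilLevi.lean` — session planner-pub-hodgecm-pv14-g6-0
(unit pub-hodgecm-pv14-g6, DAG-node prover #14, gen 6).  Intended final place:
`HodgeCM/Automorphic/SchwartzWeilLevi.lean` (namespace `HodgeCM.SchwartzWeil`).  NEW ADDITIVE LEAF.
PACKAGER: rewrite `import Pv14g6.SchwartzWeilProjective` to `import HodgeCM.Automorphic.SchwartzWeilProjective`.
Asserts nothing: no axioms, no unproved declarations.
-/
import Summits.HodgeConjecture.HodgeCM.Automorphic.SchwartzWeilProjective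
import Mathlib.Analysis.InnerProductSpace.Adjoint

/-!
# The Levi factor of the Weil representation on `𝓢(V, ℂ)`

For `A ∈ GL(V)` (`A : V ≃L[ℝ] V`) the **Levi automorphism** of the Heisenberg group
`λ_A : (a, b, u) ↦ (A a, ᵗA⁻¹ b, u)` (`Heis.leviAut A`; `ᵗA⁻¹` = the adjoint of `A⁻¹` for the inner product) is a
group automorphism, `A ↦ λ_A` is a homomorphism `GL(V) →* Aut(Heis V)`, and the **dilation operator**
`L_A Φ = Φ ∘ A⁻¹` on Schwartz space (`leviCLM V A`, Mathlib's `SchwartzMap.compCLMOfContinuousLinearEquiv`) satisfies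

  `L_A ∘ ρ_m(h) = ρ_m(λ_A h) ∘ L_A`                     (`leviCLM_comp_repCLM`)

for the weight-`m` Schrödinger representation `ρ_m = repCLM V m` (every `m`).  Hence `A ↦ (λ_A, L_A)` is a homomorphism
`GL(V) →* Mp_m(V)` into the intertwining group of `SchwartzWeilProjective` (`intertwines_levi`,
`levi_mem_mpGroup`): together with the landed Fourier transform (Weyl element) and chirps (unipotent radical) this is
the standard generating set `P = MN`, `w` of the symplectic group in the Schrödinger model, all realised on `𝓢(V, ℂ)`
by honest operators; by `Intertwines.exists_character` any other intertwining lift over `GL(V)` differs from `L` by a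
character `GL(V) →* ℂˣ`.

## References

* A. Weil, *Sur certains groupes d'opérateurs unitaires*, Acta Math. 111 (1964), n° 13, formula (11) (the operators
  attached to the "diagonal" symplectic automorphisms).
* G. Lion, M. Vergne, *The Weil representation, Maslov index and theta series* (1980), Part I, §1.6 (2.2.8).
-/

noncomputable section

open scoped SchwartzMap RealInnerProductSpace FourierTransform

namespace HodgeCM
namespace SchwartzWeil

namespace Heis

variable {V : Type*} [NormedAddCommGroup V] [InnerProductSpace ℝ V] [FiniteDimensional ℝ V]

/-- The contragredient `ᵗA⁻¹` of `A ∈ GL(V)` for the inner product: the adjoint of `A⁻¹`. -/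
def contragredient (A : V ≃L[ℝ] V) : V →ₗ[ℝ] V := LinearMap.adjoint ((A.symm : V ≃L[ℝ] V) : V →ₗ[ℝ] V)

/-- (Ported verbatim from the HodgeCMPerL package; no docstring in the source.) -/
theorem contragredient_apply_eq (A : V ≃L[ℝ] V) (b : V) :
    contragredient A b = LinearMap.adjoint ((A.symm : V ≃L[ℝ] V) : V →ₗ[ℝ] V) b := rfl

/-- `⟪A a, ᵗA⁻¹ b⟫ = ⟪a, b⟫`. -/
@[simp] theorem inner_apply_contragredient (A : V ≃L[ℝ] V) (a b : V) : ⟪A a, contragredient A b⟫ = ⟪a, b⟫ := by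
  rw [contragredient, LinearMap.adjoint_inner_right]
  simp

/-- `⟪ᵗA⁻¹ b, x⟫ = ⟪b, A⁻¹ x⟫`. -/
theorem inner_contragredient_left (A : V ≃L[ℝ] V) (b x : V) : ⟪contragredient A b, x⟫ = ⟪b, A.symm x⟫ := by
  rw [contragredient, LinearMap.adjoint_inner_left]
  rfl

/-- (Ported verbatim from the HodgeCMPerL package; no docstring in the source.) -/
@[simp] theorem contragredient_one : contragredient (1 : V ≃L[ℝ] V) = LinearMap.id := by
  apply LinearMap.ext; intro b
  apply ext_inner_right ℝ; intro x
  rw [inner_contragredient_left]; rfl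

/-- (Ported verbatim from the HodgeCMPerL package; no docstring in the source.) -/
theorem contragredient_mul (A B : V ≃L[ℝ] V) :
    contragredient (A * B) = contragredient A ∘ₗ contragredient B := by
  apply LinearMap.ext; intro b
  apply ext_inner_right ℝ; intro x
  rw [inner_contragredient_left, LinearMap.comp_apply, inner_contragredient_left, inner_contragredient_left]
  rfl

/-- Underlying map of the Levi automorphism `λ_A (a, b, u) = (A a, ᵗA⁻¹ b, u)`. -/
def leviFun (A : V ≃L[ℝ] V) (h : Heis V) : Heis V := ⟨A h.a, contragredient A h.b, h.u⟩

/-- (Ported verbatim from the HodgeCMPerL package; no docstring in the source.) -/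
@[simp] theorem leviFun_a (A : V ≃L[ℝ] V) (h : Heis V) : (leviFun A h).a = A h.a := rfl
/-- (Ported verbatim from the HodgeCMPerL package; no docstring in the source.) -/
@[simp] theorem leviFun_b (A : V ≃L[ℝ] V) (h : Heis V) : (leviFun A h).b = contragredient A h.b := rfl
/-- (Ported verbatim from the HodgeCMPerL package; no docstring in the source.) -/
@[simp] theorem leviFun_u (A : V ≃L[ℝ] V) (h : Heis V) : (leviFun A h).u = h.u := rfl

/-- (Ported verbatim from the HodgeCMPerL package; no docstring in the source.) -/
theorem leviFun_mul (A : V ≃L[ℝ] V) (h h' : Heis V) : leviFun A (h * h') = leviFun A h * leviFun A h' := by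
  ext
  · simp
  · simp
  · simp only [leviFun_u, mul_u, leviFun_a, leviFun_b, inner_apply_contragredient]

/-- (Ported verbatim from the HodgeCMPerL package; no docstring in the source.) -/
theorem leviFun_one_apply (h : Heis V) : leviFun (1 : V ≃L[ℝ] V) h = h := by
  ext
  · rfl
  · simp
  · rfl

/-- (Ported verbatim from the HodgeCMPerL package; no docstring in the source.) -/
theorem leviFun_mul_apply (A B : V ≃L[ℝ] V) (h : Heis V) : leviFun (A * B) h = leviFun A (leviFun B h) := by
  ext
  · rfl
  · simp [contragredient_mul]
  · rfl

/-- **The Levi homomorphism** `GL(V) →* Aut(Heis V)`, `A ↦ λ_A`, `λ_A (a, b, u) = (A a, ᵗA⁻¹ b, u)`. -/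
def leviAut : (V ≃L[ℝ] V) →* MulAut (Heis V) where
  toFun A :=
    { toFun := leviFun A
      invFun := leviFun A⁻¹
      left_inv := fun h => by rw [← leviFun_mul_apply, inv_mul_cancel, leviFun_one_apply]
      right_inv := fun h => by rw [← leviFun_mul_apply, mul_inv_cancel, leviFun_one_apply]
      map_mul' := leviFun_mul A }
  map_one' := MulEquiv.ext leviFun_one_apply
  map_mul' A B := MulEquiv.ext (leviFun_mul_apply A B)

/-- (Ported verbatim from the HodgeCMPerL package; no docstring in the source.) -/
@[simp] theorem leviAut_apply (A : V ≃L[ℝ] V) (h : Heis V) : leviAut A h = ⟨A h.a, contragredient A h.b, h.u⟩ := rfl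

/-- `λ_A` fixes the centre pointwise. -/
theorem leviAut_center (A : V ≃L[ℝ] V) (z : Circle) : leviAut A (center z : Heis V) = center z := by
  ext
  · simp [center]
  · simp [center]
  · rfl

end Heis

section Dilation

variable (V : Type) [NormedAddCommGroup V] [InnerProductSpace ℝ V]

/-- **The dilation operator** `L_A Φ = Φ ∘ A⁻¹` on `𝓢(V, ℂ)`. -/
def leviCLM (A : V ≃L[ℝ] V) : 𝓢(V, ℂ) →L[ℂ] 𝓢(V, ℂ) :=
  SchwartzMap.compCLMOfContinuousLinearEquiv ℂ (A.symm : V ≃L[ℝ] V)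

/-- (Ported verbatim from the HodgeCMPerL package; no docstring in the source.) -/
@[simp] theorem leviCLM_apply (A : V ≃L[ℝ] V) (Φ : 𝓢(V, ℂ)) (x : V) : leviCLM V A Φ x = Φ (A.symm x) := rfl

/-- (Ported verbatim from the HodgeCMPerL package; no docstring in the source.) -/
theorem leviCLM_one : leviCLM V 1 = ContinuousLinearMap.id ℂ 𝓢(V, ℂ) := by
  refine ContinuousLinearMap.ext fun Φ => ?_
  ext x; rfl

/-- (Ported verbatim from the HodgeCMPerL package; no docstring in the source.) -/
theorem leviCLM_mul (A B : V ≃L[ℝ] V) : leviCLM V (A * B) = (leviCLM V A).comp (leviCLM V B) := by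
  refine ContinuousLinearMap.ext fun Φ => ?_
  ext x; rfl

/-- **The dilation operators as a homomorphism** `GL(V) →* GL(𝓢(V, ℂ))`. -/
def leviUnit : (V ≃L[ℝ] V) →* (𝓢(V, ℂ) →L[ℂ] 𝓢(V, ℂ))ˣ where
  toFun A :=
    { val := leviCLM V A
      inv := leviCLM V A⁻¹
      val_inv := by rw [ContinuousLinearMap.mul_def, ← leviCLM_mul, mul_inv_cancel, leviCLM_one]; rfl
      inv_val := by rw [ContinuousLinearMap.mul_def, ← leviCLM_mul, inv_mul_cancel, leviCLM_one]; rfl }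
  map_one' := Units.ext (by
    change leviCLM V 1 = 1
    rw [leviCLM_one]; rfl)
  map_mul' A B := Units.ext (by
    change leviCLM V (A * B) = leviCLM V A * leviCLM V B
    rw [ContinuousLinearMap.mul_def, leviCLM_mul])

/-- (Ported verbatim from the HodgeCMPerL package; no docstring in the source.) -/
@[simp] theorem val_leviUnit (A : V ≃L[ℝ] V) : (leviUnit V A : 𝓢(V, ℂ) →L[ℂ] 𝓢(V, ℂ)) = leviCLM V A := rfl

end Dilation

section Levi

variable (V : Type) [NormedAddCommGroup V] [InnerProductSpace ℝ V] [FiniteDimensional ℝ V] [MeasurableSpace V]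
  [BorelSpace V] (m : ℤ)

/-- **`L_A ∘ ρ_m(h) = ρ_m(λ_A h) ∘ L_A`**: dilations intertwine the Schrödinger representation along the Levi
automorphisms (every weight `m`). -/
theorem leviCLM_comp_repCLM (A : V ≃L[ℝ] V) (h : Heis V) :
    (leviCLM V A).comp (repCLM V m h) = (repCLM V m (Heis.leviAut A h)).comp (leviCLM V A) := by
  refine ContinuousLinearMap.ext fun Φ => ?_
  ext x
  simp only [ContinuousLinearMap.comp_apply, leviCLM_apply, repCLM_apply, Heis.leviAut_apply, map_sub,
    ContinuousLinearEquiv.symm_apply_apply, real_inner_smul_left, Heis.inner_contragredient_left]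

/-- (Ported verbatim from the HodgeCMPerL package; no docstring in the source.) -/
theorem leviCLM_repCLM_apply (A : V ≃L[ℝ] V) (h : Heis V) (Φ : 𝓢(V, ℂ)) :
    leviCLM V A (repCLM V m h Φ) = repCLM V m (Heis.leviAut A h) (leviCLM V A Φ) := by
  simpa only [ContinuousLinearMap.comp_apply] using
    congrArg (fun T : 𝓢(V, ℂ) →L[ℂ] 𝓢(V, ℂ) => T Φ) (leviCLM_comp_repCLM V m A h)

/-- **The Levi factor lies in the intertwining group**: `(λ_A, L_A) ∈ Mp_m(V)`. -/
theorem levi_mem_mpGroup (A : V ≃L[ℝ] V) : (Heis.leviAut A, leviUnit V A) ∈ mpGroup V m := by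
  intro h
  rw [eq_mul_inv_iff_mul_eq]
  refine Units.ext ?_
  simp only [Units.val_mul, val_repUnits, val_leviUnit, ContinuousLinearMap.mul_def]
  exact (leviCLM_comp_repCLM V m A h).symm

/-- `A ↦ (λ_A, L_A)` is an intertwining lift of the Levi action: `Intertwines V m leviAut leviUnit`. -/
theorem intertwines_levi : Intertwines V m (Heis.leviAut (V := V)) (leviUnit V) := fun A h =>
  levi_mem_mpGroup V m A h

/-- The Levi homomorphism into the intertwining group `GL(V) →* Mp_m(V)`. -/
def leviMp : (V ≃L[ℝ] V) →* mpGroup V m where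
  toFun A := ⟨(Heis.leviAut A, leviUnit V A), levi_mem_mpGroup V m A⟩
  map_one' := Subtype.ext (Prod.ext (map_one _) (map_one _))
  map_mul' A B := Subtype.ext (Prod.ext (map_mul _ A B) (map_mul _ A B))

/-- (Ported verbatim from the HodgeCMPerL package; no docstring in the source.) -/
@[simp] theorem mpProj_leviMp (A : V ≃L[ℝ] V) : mpProj V m (leviMp V m A) = Heis.leviAut A := rfl

/-- **Uniqueness of the Levi operators up to a character**: any intertwining lift of the Levi action over `GL(V)`
differs from `A ↦ L_A` by a character `GL(V) →* ℂˣ` (`m ≠ 0`). -/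
theorem levi_unique_up_to_character (hm : m ≠ 0) {π : (V ≃L[ℝ] V) →* (𝓢(V, ℂ) →L[ℂ] 𝓢(V, ℂ))ˣ}
    (hπ : Intertwines V m (Heis.leviAut (V := V)) π) :
    ∃ c : (V ≃L[ℝ] V) →* ℂˣ, ∀ A, π A = scalarUnits V (c A) * leviUnit V A :=
  (intertwines_levi V m).exists_character hm hπ

end Levi

end SchwartzWeil
end HodgeCM

end
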